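import Mathlib
import Literature.Analysis.FluidPDE.Tao2016AveragedNS.RestartedCascadeFlows
import Summits.NavierStokesRegularity.NavierStokesRegularity.Theses.TaoLadderRungThree
import Summits.NavierStokesRegularity.NavierStokesRegularity.Theorems.TaoLadderRungThreeGappedFrontRobustInertPhantomFront
import Summits.NavierStokesRegularity.NavierStokesRegularity.Theorems.TaoLadderRungThreeGappedFrontRobustStepTransfer
import Summits.NavierStokesRegularity.NavierStokesRegularity.Theorems.TaoLadderRungThreeGappedFrontRobustV2Closeness

/-! ## K_B₂ = `GappedFrontRobustV2` (item stmt-NavierStokesRegularity-22114, routes TaoLadderRungThree /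
RungTwo / RungTwoPoly; line `threezone`, p1 g9 skeleton, p1 g10 proof). MODEL lattice statements (Tao 2016
§4/§6 cascade vocabulary of `RestartedCascadeFlows`); nothing here is about the Navier–Stokes equations.

THEOREM. For every `R`-comparable symmetric cancelling four-mode table `α` at scale ratio `1+ε₀ > 1`, format-v2
gap data `GapData₂ σ ε₀ i₀ α X₀ Z w r ρ θ₀ θ c₀ c env₀` together with the thin-tail clause (the inline spelling of
`TaoCascade.TailThin ε₀ w r`) yield a margin `η > 0` and an epoch envelope `env` with BOTH clauses of a robust
front step for the ball description: `FrontExists` (defect-free flows exist on the clock window from every ball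
state with admissible slack) and `RobustStep` (every `(η, η)`-pseudo-flow steps into the `r`-ball).

PROOF (three zones). The registered stub `stub_closeness` is the landed
`…Theorems.GappedFrontRobust.gappedFrontRobustV2_closeness` (used directly below): the
non-circular selection of the constants (deviation target `ψ_max`, top of the front block `kt`, block scale `E⋆`,
bottom `kb`, the exact flow's envelope `A⁰` and the row-sum constant `Γ`, profile `ψ₀ e^{4Γt}`, tail target
`ν = ψ₀/2`, tail closing `(ϑ, β₀)`, tail start `k₂`, two-piece envelope `env`, margin `η`) followed by
`stepCloseness_core`: the exact flow's a priori envelope (`pseudoFlowOn_block_and_behind` behind and on the front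
block, the certificate's tail envelope beyond), the tail zones of both flows (`pseudoFlowOn_tail_zone`, for the
pseudo-flow on every initial window from the weak deviation at the base shell), and the active-zone bootstrap
(`pseudoFlowOn_active_zone''`, tail and defect budgets inside the bootstrap); the envelope's slack weights are
bounded uniformly in the number of past epochs (`slackWeight_le_of_supersolution`). The composition
`GappedFrontRobustV2_of` (registered skeleton 89360ef9ba32ffb6): exact flow from (exist₀), exact step with
slack from `StepSlack`, (front) by `frontExists_of_gapData`, (step) by `stepTo_transfer`. -/

noncomputable section

-- the sub-problem namespace repeats the summit name by design (D-0017)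
set_option linter.dupNamespace false

namespace Summit.NavierStokesRegularity.NavierStokesRegularity.Cruxes.GappedFrontRobustV2.ThreeZone

open Set Literature.Analysis.FluidPDE Literature.Analysis.FluidPDE.TaoCascade
open Summit.NavierStokesRegularity.NavierStokesRegularity.Theorems.GappedFrontRobust

/-- **K_B₂ `GappedFrontRobustV2` (stmt-NavierStokesRegularity-22114) BY NAME**: format-v2 gap data with a thin
tail yield a robust front step (both clauses, shared witnesses `η`, `env`) for the ball description.
[cite: Tao2016AveragedNS, §6.3–6.4 Props. 6.4–6.5 (statement shape); §4 Lemma 4.1 (4.5), (4.8)–(4.10)] -/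
theorem GappedFrontRobustV2_of :
    Summit.NavierStokesRegularity.NavierStokesRegularity.Theses.TaoLadderRungThree.GappedFrontRobustV2 := by
  intro R σ ε₀ i₀ α X₀ Z w r ρ θ₀ θ c₀ c env₀ hα hε hgap hthin
  -- the line's single stub `stub_closeness` IS the landed `gappedFrontRobustV2_closeness`
  obtain ⟨η, hη, env, hdec, hclose⟩ :=
    gappedFrontRobustV2_closeness R σ ε₀ i₀ α X₀ Z w r ρ θ₀ θ c₀ c env₀ hα hε hgap hthin
  have hgap1 : GapData ε₀ i₀ α X₀ Z w r ρ θ₀ θ c₀ c env₀ := hgap.1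
  refine ⟨η, env, hη, frontExists_of_gapData hε hgap1 hη hdec, ?_⟩
  -- the (step) clause
  intro L S₀ F₀ B₀ hball hB τ hτc S' F' hflow'
  obtain ⟨hr, hρ0, hρ1, hθ₀, hθ₀θ, hθ, hc₀, hc₀c, hw1, -, -, hex, -⟩ := hgap1
  obtain ⟨hσ, -, hslack, -⟩ := hgap.2
  -- the exact zero-slack flow from the same ball state, on the clock window [0, c]
  obtain ⟨z, hz, hzr⟩ := hball
  obtain ⟨S, F, hSF⟩ := hex S₀ ⟨z, hz, hzr⟩
  -- its step with amplitude slack (StepSlack with horizon τ := c ≥ c₀)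
  obtain ⟨τ₁, a, hstep, hmargin⟩ := hslack S₀ c S F ⟨z, hz, hzr⟩ hc₀c.le hSF
  -- the three closeness facts
  obtain ⟨hfront, hballc, henv⟩ :=
    hclose L S₀ F₀ B₀ ⟨z, hz, hzr⟩ hB τ hτc S' F' hflow' S F hSF τ₁ a hstep hmargin
  -- transfer the step
  refine ⟨τ₁, a, stepTo_transfer hε.le hθ₀θ.le hc₀c.le (fun k => (zero_le_one.trans (hw1 k)))
    hstep (by linarith) hfront hballc henv⟩

end Summit.NavierStokesRegularity.NavierStokesRegularity.Cruxes.GappedFrontRobustV2.ThreeZone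

end
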